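import Mathlib
import Summits.Ventures.PercRepro2.Defs
import Summits.Ventures.PercRepro2.Graph
import Summits.Ventures.PercRepro2.Induced
import Summits.Ventures.PercRepro2.VdBKahn
import Summits.Ventures.PercRepro2.ReimerVdBK
import Summits.Ventures.PercRepro2.ReimerVdBKTwisted
import Summits.Ventures.PercRepro2.ReimerVdBKTied
import Summits.Ventures.PercRepro2.ReimerVdBKCoreDown
import Summits.Ventures.PercRepro2.ReimerVdBKDegTwoCalc
import Summits.Ventures.PercRepro2.ReimerVdBKOuter
import Summits.Ventures.PercRepro2.ReimerVdBKPatch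
import Summits.Ventures.PercRepro2.ReimerVdBKOuterStars
import Summits.Ventures.PercRepro2.ReimerVdBKCellEdges
import Summits.Ventures.PercRepro2.ReimerVdBKCell
import Summits.Ventures.PercRepro2.ReimerVdBKCellCoin

/-!
# Sets of `X`-vertices take one coin, sets of `Y`-vertices take none (`N = ∅`)
(blind cell PercRepro2, mine-c g50; `conjectures/MINE-C.md` §59.0 / §59.3 — part IV of the cell theorem;
parts I–III: `ReimerVdBKCellEdges`, `ReimerVdBKCell`, `ReimerVdBKCellCoin`)

Two corollaries of the cell theorem `count_cell_le` with CONSTANT forced sets (no inner edge needed):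
* `oneCoin_of_subset_X`: for every revealed set `R ⊆ X` (vertices avoided by world 1), the ONE-COIN statement
  `OneCoin … ∅ R` holds — every cell pairs with the cell of the pattern with ALL the edges at `R` flipped
  (`FX = R`, `FY = ∅`, `T = R`), an involution of the one-coin fibre;
* `count_onF_FE_le_of_subset_Y`: for every `R ⊆ Y` (vertices avoided by world 2), the EXACT REVEAL holds —
  on the sub-cube of every outer pattern the left count is at most the right count (`FX = ∅`, `FY = R`,
  `T = ∅`, every cell paired with itself; `count_cell_le_of_subset_Y`).
With `oneCoin_adjacent_XY` these are the three pair shapes of the pairing-group lattice at `N = ∅`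
(`MINE-C.md` §59.1 (b)): `X`–`X` needs the joint coin, `Y`–`Y` needs no coin at all, `X`–`Y` needs the
`X`-star flipped (`ReimerVdBKOuterOneWorld`) or, when adjacent, the joint coin.
-/

namespace Summit.Ventures.PercRepro2
namespace ReimerVdBK
open Classical

variable {V : Type*} {E : Type*} [Fintype E] [DecidableEq E] [Fintype V] [DecidableEq V]

section Main
variable (ends : E → Sym2 V) (s : V) (A X B Y R : Finset V)

omit [Fintype E] [Fintype V] [DecidableEq V] in
/-- Flipping a superset of `F` preserves the shifted tied set of `F`. -/
lemma flipOn_superset_mem_shiftTied_iff (c ω : Config E) {F G : Finset E} (hFG : F ⊆ G) :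
    flipOn G ω ∈ shiftTied c F ↔ ω ∈ shiftTied c F := by
  have key : ∀ ω : Config E, ω ∈ shiftTied c F → flipOn G ω ∈ shiftTied c F := by
    intro ω hω e he e' he'
    have h1 := hω e he e' he'
    rw [flipOn_of_mem _ (hFG he), flipOn_of_mem _ (hFG he')]
    revert h1
    cases ω e <;> cases ω e' <;> cases c e <;> cases c e' <;> decide
  refine ⟨fun h => ?_, key ω⟩
  have := key _ h
  rwa [flipOn_involutive] at this

/-- **The cell inequality for a set of `X`-vertices**: the cell of `d` pairs with the cell of the pattern
with all the edges at `R` flipped. -/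
theorem count_cell_le_of_subset_X (hR : R ⊆ X) (hXY : X ∩ Y = ∅) (d : Config E) :
    count (twoWorld ends s A X B Y ∩ onF (edgesTouching ends R) d) ≤
      count (twoWorld ends s (A ∪ B) ∅ ∅ (X ∪ Y) ∩ onF (edgesTouching ends R) (flipOn (edgesTouching ends R) d)) := by
  refine count_cell_le ends s A X B Y R R ∅ Finset.inter_subset_left ?_ R (le_refl _) ?_ d _ ?_ ?_ ?_ ?_ ?_ ?_
  · intro w hw
    have hwX := hR (Finset.mem_inter.1 hw).1
    exact absurd (hXY ▸ Finset.mem_inter.2 ⟨hwX, (Finset.mem_inter.1 hw).2⟩) (Finset.notMem_empty w)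
  · exact Finset.sdiff_subset
  · intro ω' hω' w hw
    exact hω'.1.2 w (hR hw)
  · intro _ _ w hw
    exact absurd hw (Finset.notMem_empty w)
  · intro e heR _ hnone
    obtain ⟨w, hw, hwe⟩ := (mem_edgesAt_iff ends).1 heR
    exact absurd hwe (hnone w hw)
  · intro e heR _ _
    rw [flipOn_of_mem _ heR]
  · intro w hw e he
    exact flipOn_of_mem _ (outerStar_subset_edgesAt ends hw he) d
  · intro w hw
    exact absurd (Finset.mem_sdiff.1 hw).1 (Finset.mem_sdiff.1 hw).2

/-- **Sets of `X`-vertices take one coin at `N = ∅`**: for every `R ⊆ X`, `OneCoin … ∅ R` — the joint flip of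
all the outer stars of `R` is the only pairing needed (`MINE-C.md` §59.1: the `X`–`X` pairs and the `XXX`
triples, adjacent or not). -/
theorem oneCoin_of_subset_X (hR : R ⊆ X) (hXY : X ∩ Y = ∅) : OneCoin ends s A X B Y ∅ R := by
  intro c
  rw [coinCount_empty_N, coinCount_empty_N]
  set CE := edgesTouching ends R with hCE
  have hFib : ∀ ω ω' : Config E, (∀ e ∈ CE, ω e = ω' e) → ω ∈ coinFibre ends c R → ω' ∈ coinFibre ends c R :=
    fun ω ω' h hω => mem_shiftTied_of_agree (fun e he => h e (FE_subset_edgesAt ends _ he)) hω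
  have h1 := mul_count_inter_eq_sum_onF CE (twoWorld ends s A X B Y) (coinFibre ends c R) hFib
  have h2 := mul_count_inter_eq_sum_onF CE (twoWorld ends s (A ∪ B) ∅ ∅ (X ∪ Y)) (coinFibre ends c R) hFib
  refine Nat.le_of_mul_le_mul_left ?_ (count_univ_cell_pos ends R)
  rw [h1, h2]
  have hpres : ∀ d : Config E, flipOn CE d ∈ coinFibre ends c R ↔ d ∈ coinFibre ends c R :=
    fun d => flipOn_superset_mem_shiftTied_iff c d (FE_subset_edgesAt ends R)
  have h3 : ∀ d : Config E,
      (if d ∈ coinFibre ends c R then count (twoWorld ends s A X B Y ∩ onF CE d) else 0) ≤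
        (if d ∈ coinFibre ends c R then
          count (twoWorld ends s (A ∪ B) ∅ ∅ (X ∪ Y) ∩ onF CE (flipOn CE d)) else 0) := by
    intro d
    split_ifs with hd
    · exact count_cell_le_of_subset_X ends s A X B Y R hR hXY d
    · exact le_refl 0
  calc ∑ d : Config E, (if d ∈ coinFibre ends c R then count (twoWorld ends s A X B Y ∩ onF CE d) else 0)
      ≤ ∑ d : Config E, (if d ∈ coinFibre ends c R then
          count (twoWorld ends s (A ∪ B) ∅ ∅ (X ∪ Y) ∩ onF CE (flipOn CE d)) else 0) :=
        Finset.sum_le_sum fun d _ => h3 d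
    _ = ∑ d : Config E, (if flipOn CE d ∈ coinFibre ends c R then
          count (twoWorld ends s (A ∪ B) ∅ ∅ (X ∪ Y) ∩ onF CE (flipOn CE d)) else 0) := by
        refine Finset.sum_congr rfl fun d _ => ?_
        rw [hpres d]
    _ = ∑ d : Config E, (if d ∈ coinFibre ends c R then
          count (twoWorld ends s (A ∪ B) ∅ ∅ (X ∪ Y) ∩ onF CE d) else 0) :=
        Equiv.sum_comp (Function.Involutive.toPerm _ (flipOn_involutive CE))
          (fun d => if d ∈ coinFibre ends c R then
            count (twoWorld ends s (A ∪ B) ∅ ∅ (X ∪ Y) ∩ onF CE d) else 0)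

/-- **The cell inequality for a set of `Y`-vertices**: every cell pairs with itself. -/
theorem count_cell_le_of_subset_Y (hR : R ⊆ Y) (hXY : X ∩ Y = ∅) (d : Config E) :
    count (twoWorld ends s A X B Y ∩ onF (edgesTouching ends R) d) ≤
      count (twoWorld ends s (A ∪ B) ∅ ∅ (X ∪ Y) ∩ onF (edgesTouching ends R) d) := by
  refine count_cell_le ends s A X B Y R ∅ R ?_ Finset.inter_subset_left ∅ (le_refl _) ?_ d d ?_ ?_ ?_ ?_ ?_ ?_
  · intro w hw
    have hwY := hR (Finset.mem_inter.1 hw).1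
    exact absurd (hXY ▸ Finset.mem_inter.2 ⟨(Finset.mem_inter.1 hw).2, hwY⟩) (Finset.notMem_empty w)
  · intro w hw
    exact absurd (Finset.mem_sdiff.1 hw).1 (Finset.mem_sdiff.1 hw).2
  · intro _ _ w hw
    exact absurd hw (Finset.notMem_empty w)
  · intro ω' hω' w hw
    exact hω'.2.2 w (hR hw)
  · intro e _ _ _
    exact le_refl _
  · intro e heR _ hnone
    obtain ⟨w, hw, hwe⟩ := (mem_edgesAt_iff ends).1 heR
    exact absurd hwe (hnone w hw)
  · intro w hw
    exact absurd hw (Finset.notMem_empty w)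
  · intro _ _ _ _
    rfl

/-- **Sets of `Y`-vertices can be revealed exactly at `N = ∅`**: for every `R ⊆ Y` and every outer pattern
`d`, the left count on the sub-cube of `d` is at most the right count on the same sub-cube — the fibre
statement with the trivial group (`MINE-C.md` §59.1: `Y`–`Y` pairs and `YYY` triples pass with every
subgroup, even `{0}`). -/
theorem count_onF_FE_le_of_subset_Y (hR : R ⊆ Y) (hXY : X ∩ Y = ∅) (d : Config E) :
    count (twoWorld ends s A X B Y ∩ onF (FE ends R) d) ≤
      count (twoWorld ends s (A ∪ B) ∅ ∅ (X ∪ Y) ∩ onF (FE ends R) d) := by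
  set CE := edgesTouching ends R with hCE
  have hFib : ∀ ω ω' : Config E, (∀ e ∈ CE, ω e = ω' e) → ω ∈ onF (FE ends R) d → ω' ∈ onF (FE ends R) d :=
    fun ω ω' h hω e he => by rw [← h e (FE_subset_edgesAt ends R he)]; exact hω e he
  have h1 := mul_count_inter_eq_sum_onF CE (twoWorld ends s A X B Y) (onF (FE ends R) d) hFib
  have h2 := mul_count_inter_eq_sum_onF CE (twoWorld ends s (A ∪ B) ∅ ∅ (X ∪ Y)) (onF (FE ends R) d) hFib
  refine Nat.le_of_mul_le_mul_left ?_ (count_univ_cell_pos ends R)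
  rw [h1, h2]
  refine Finset.sum_le_sum fun d' _ => ?_
  split_ifs with hd
  · exact count_cell_le_of_subset_Y ends s A X B Y R hR hXY d'
  · exact le_refl 0

end Main

end ReimerVdBK
end Summit.Ventures.PercRepro2
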